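import Summits.QuantumFields.BalabanUV.T4Continuum.Support.VariationalColourTaxiTowerBridge
import Summits.QuantumFields.BalabanUV.T4Continuum.Support.VariationalVectorFrameTower
import Summits.QuantumFields.BalabanUV.T4Continuum.Support.VectorLineTransportFrame

/-!
# T⁴ programme, spine node NE2 (U1a), lane P2 — THE FINE V-UB LEAF FOR THE SUPPLIER's COMPOSITE FIBRE AT BAŁABAN's TAXI DATA, k-UNIFORMLY: frame-adapted one-step
# carriers `frameT (taxiTv (R′ k)) (Rlev k)` under the nested carriers `nestLv k`, functional = the composite-kernel `projG` (item «ONE-MIN AT TAXI DATA — THE COMPOSITE-FIBRE ↔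
# TAXI-FRAME BRIDGE», file 5; model level; cell `pub-balaban`)

NE2 formalisation swarm `b2b-balaban-t4-ne2-formalise-*`, leaf prover 04 GEN 7 (`prover-b2b-balaban-t4-ne2-formalise-leaf-04-g7-0`); register row «P2-sup» of
`t4/formal/NE2/LEAVES.md`; journal CLAIMS.log INTENT 2026-08-20 l.21025, bridge LANDED l.21849.  Compositions BY NAME: leaf-03-g4's `VectorLineTransportFrame.exists_ubV_nearFrame_ScV`
(V-UB for carriers NEAR a frame-adapted reference, p220640), leaf-10-g3's `VariationalVectorFrameTower.{norm_compL_sub_compL_le, norm_compL_frameT_sub_le, norm_frameT_le_one}`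
(p223250) and `VariationalVectorTower.ubV_transport`, this lineage's gen 4 `VariationalColourTaxiTowerStep.nestLv_sub_lineT_le` ((E_k)), `VariationalVectorTaxiOneStep.
lineT_sub_frameT_taxi_le`, `VariationalColourTaxiTransport.{inBlock_defect_taxiTv_le, cross_defect_taxiTv_le}`, file 2 `CompositeTaxiFrameGap.inBlock_defect_compTv_le`,
leaf-03-g7's `CompositeFibreRelabel.projG_taxiTwoStep_eq`, part 6's `hGF_projG_taxi`.  Nothing defined.

WHY.  leaf-01-g9's `hONEm_centred_reg` displays, among its inputs, the fine V-UB `hUBfV : ∀ φ, ∃ W′, Q_k(Q₁ W′) = φ ∧ SfV (R′ k) G₁′ W′ ≤ Λᵥ·nsqV φ` for ITS carriers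
`Q₁ = QvL L _ (frameT L _ (taxiTv (R′ k)) (Rlev k))` and ITS functional `G₁′ = projG (R′ k) (ker (Q_T ∘ Q_{T′}))`, and `Λᵥ` enters `ε⋆` as `(1+u⁻¹)Λᵥ(25∕4)n⁻²(C_Går+C_Går′)`
— so `Λᵥ` must be k-UNIFORM (a one-step composition over a coarse competitor would cost a factor `n²`).  The k-uniform supplier is the level-(k+1) V-UB for carriers near a
frame-adapted reference: the two-level carriers `compL (nestLv k) (frameT (taxiTv (R′ k)) (Rlev k))` are `γ_F`-close to `frameT (L^{k+1}) M (compTv (taxi_k) (taxi′_k)) (Rc)`,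
`Rc = coarseTv (L^k) M (Rlev k)` the unit-lattice bond, with `γ_F = (E_k) + 3(d−1)L^k(L^k−1)a_k + (d−1)(L^k−1)(2L^k−1)a_k = O(d²c)` k-UNIFORM under the class.

THE STATEMENTS ([folklore]; `E = ℂ` as parts 6–8; level `k` fixed; `T := taxiTv (L^k) M (Rlev k)`, `T′ := taxiTv L (fine (L^k) M) (R′ k)`, plaquette class of `Rlev k` `≤ a`):
 * §1 `Gtr_G1'` (leaf-03-g7's relabelling in `Gtr` form), `taxi_hin` ∕ `taxi_hcross` (gen 4's in-block ∕ face consistency of the straight taxi in the letters of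
   `norm_compL_frameT_sub_le`, `m = (d−1)(L^k−1)(2L^k−1)a`), **`compL_nestLv_frameT_near`**: `‖compL (nestLv k) (frameT T′ (Rlev k)) − frameT (L^k·L) M (compTv T T′) Rc‖ ≤ γ_F`.
 * §2 **`hUBfV_taxi`**: `∀ φ, ∃ W′, QvL (nestLv k) (QvL L _ (frameT T′ (Rlev k)) W′) = φ ∧ SfV (R′ k) G₁′ W′ ≤ (lamV d ((L^k·L)·w_k) d 0 ∕ (1 − κᵥ⁻¹γ_F)²)·nsqV φ`,
   `w_k = (d−1)(L−1)(2L−1)b_k + (d−1)(L^k−1)a_k` (file 2's composite-frame class), under the ONE displayed smallness `κᵥ(d, L^k·L)⁻¹·γ_F < 1` (k-uniform: `κᵥ⁻¹ ≤ 60·6^{d−1}`,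
   `γ_F = O(d²c)`).
NOT HERE: the courier itself (next file), the class bookkeeping.

HONEST FRAMING (T4-DAG p. 1).  Rung (B)+1 only — NOT infinite volume, NOT a mass gap, NOT Clay.  NE2 NOT IN PRINT, NOT proved here.  MODEL LEVEL (c5): bond ∕ site operators
DATA, taxi contours, carriers and gauge fixings OURS; [folklore] bookkeeping over landed leaves; nothing printed is a hypothesis; no `def`, no `def … : Prop`, no `sorry`; axioms
standard.  V-END with background ∕ NE2 NOT proved; NE3 OPEN; spine PROVED 0∕9 unchanged.  HONEST DEPENDENCY (cell, verbatim): continuum YM on T⁴ ⇐ BetaPertH ∧ nine spine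
estimates (0/9 proved); BetaPertH ⇐ (D1) ∧ (D4) ∧ CAP+tail; G-an2-4 gates asym, D1 and NE2/3/4.
-/

noncomputable section

namespace Summit.QuantumFields.BalabanUV.T4Continuum.VariationalColourTaxiTransport

open Finset
open Literature.MathematicalPhysics.QuantumFieldTheory.Balaban1983to89.B5Prop11Plancherel (Tor fine unitVec)
open Literature.MathematicalPhysics.QuantumFieldTheory.Balaban1983to89.B5Block118 (bpt)
open Literature.MathematicalPhysics.QuantumFieldTheory.Balaban1983to89.B5Composition116 (sites)
open Summit.QuantumFields.BalabanUV.T4Continuum.VariationalColourFederbush (norm_le_one_of_mem_unitary)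
open Summit.QuantumFields.BalabanUV.T4Continuum.VariationalColourTower (compTv Rtrv compTv_mem_unitary norm_compTv_le_one)
open Summit.QuantumFields.BalabanUV.T4Continuum.VariationalVectorFederbush (lineT)
open Summit.QuantumFields.BalabanUV.T4Continuum.VariationalVectorInterpolant (frameT)
open Summit.QuantumFields.BalabanUV.T4Continuum.VectorBlockTrialForm (nsqV nsqV_nonneg QvL roughV kappaV compL exists_ubV_nearFrame_ScV)
open Summit.QuantumFields.BalabanUV.T4Continuum.VariationalVectorForm (ScV SfV lamV lamV_nonneg)
open Summit.QuantumFields.BalabanUV.T4Continuum.VariationalVectorTower (Gtr ubV_transport)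
open Summit.QuantumFields.BalabanUV.T4Continuum.VariationalVectorGaugeSlice (avgOp projG projG_nonneg)
open Summit.QuantumFields.BalabanUV.T4Continuum.VariationalVectorFrameTower (norm_compL_sub_compL_le norm_compL_frameT_sub_le norm_frameT_le_one)
open Summit.QuantumFields.BalabanUV.T4Continuum.CompositeFibreRelabel (projG_taxiTwoStep_eq)
open Summit.QuantumFields.BalabanUV.T4Continuum.CompositeTaxiFrameGap (inBlock_defect_compTv_le)

variable {d : ℕ}
variable (L : ℕ) [NeZero L] (M : Fin d → ℕ) [hM : ∀ μ, NeZero (M μ)]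
variable {R' : (k : ℕ) → Tor (fine L (fine (L ^ k) M)) → Fin d → (ℂ →L[ℂ] ℂ)} (hU : ∀ k x μ, R' k x μ ∈ unitary (ℂ →L[ℂ] ℂ)) {b : ℕ → ℝ}
  (hb : ∀ k x κ ι, ‖R' k x κ * R' k (x + unitVec (fine L (fine (L ^ k) M)) κ) ι - R' k x ι * R' k (x + unitVec (fine L (fine (L ^ k) M)) ι) κ‖ ≤ b k)
  (hcoh : ∀ k, coarseTv L (fine (L ^ (k + 1)) M) (R' (k + 1)) = Rtrv (L ^ k) L M (R' k))

/-! ## §1 The supplier's functional in `Gtr` form and the nearness of the two-level carriers to a frame-adapted reference -/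

section Near

/-- **leaf-03-g7's relabelling in `Gtr` form**: `Gtr (projG (R′ k) (ker (Q_T ∘ Q_{T′}))) = projG (Rlev (k+1)) (ker Q_{compTv T T′})`. [folklore] -/
theorem Gtr_G1' (k : ℕ) :
    Gtr (L ^ k) L M (projG (fine L (fine (L ^ k) M)) (R' k)
        (LinearMap.ker ((avgOp (L ^ k) M (taxiTv (L ^ k) M (Rlev L M R' k))).comp (avgOp L (fine (L ^ k) M) (taxiTv L (fine (L ^ k) M) (R' k))))))
      = projG (fine (L ^ (k + 1)) M) (Rlev L M R' (k + 1))
          (LinearMap.ker (avgOp (L ^ (k + 1)) M (compTv (L ^ k) L M (taxiTv (L ^ k) M (Rlev L M R' k)) (taxiTv L (fine (L ^ k) M) (R' k))))) := by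
  funext W
  unfold Gtr
  rw [projG_taxiTwoStep_eq]
  congr 1
  funext x
  simp

include hU in
/-- gen 4's in-block consistency of the straight level-k taxi, in `norm_compL_frameT_sub_le`'s letter: `‖T x ∘ R(x,μ) − T(x+e_μ)‖ ≤ (d−1)(L^k−1)(2L^k−1)·a`. [folklore] -/
theorem taxi_hin (k : ℕ) {a : ℝ}
    (ha : ∀ x κ ι, ‖Rlev L M R' k x κ * Rlev L M R' k (x + unitVec (fine (L ^ k) M) κ) ι - Rlev L M R' k x ι * Rlev L M R' k (x + unitVec (fine (L ^ k) M) ι) κ‖ ≤ a)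
    (y : Tor M) (j : Fin d → Fin (L ^ k)) (μ : Fin d) (hj : (j μ : ℕ) + 1 < L ^ k) :
    ‖taxiTv (L ^ k) M (Rlev L M R' k) (bpt (L ^ k) M y j) * Rlev L M R' k (bpt (L ^ k) M y j) μ - taxiTv (L ^ k) M (Rlev L M R' k) (bpt (L ^ k) M y j + unitVec (fine (L ^ k) M) μ)‖
      ≤ ((d - 1 : ℕ) : ℝ) * ((L ^ k - 1 : ℕ) : ℝ) * ((2 * L ^ k - 1 : ℕ) : ℝ) * a := by
  have hR : ∀ x μ, ‖Rlev L M R' k x μ‖ ≤ 1 := fun x μ => norm_le_one_of_mem_unitary (Rlev_mem_unitary L M hU k x μ)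
  have ha0 : 0 ≤ a := (norm_nonneg _).trans (ha (bpt (L ^ k) M y j) μ μ)
  have h := inBlock_defect_taxiTv_le (L ^ k) M hR ha y j μ hj
  rw [norm_sub_rev] at h
  refine h.trans ?_
  have h1 : (1 : ℝ) ≤ ((2 * L ^ k - 1 : ℕ) : ℝ) := by
    have : 1 ≤ L ^ k := Nat.one_le_pow _ _ (NeZero.pos L)
    exact_mod_cast (by omega : 1 ≤ 2 * L ^ k - 1)
  have h0 : 0 ≤ ((d - 1 : ℕ) : ℝ) * ((L ^ k - 1 : ℕ) : ℝ) * a := by positivity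
  nlinarith [mul_le_mul_of_nonneg_left h1 h0]

include hU in
/-- gen 4's FACE consistency of the straight level-k taxi: `‖T x ∘ R(x,μ) − Rc(y,μ) ∘ T(x+e_μ)‖ ≤ (d−1)(L^k−1)(2L^k−1)·a` across a unit-block face,
`Rc = coarseTv (L^k) M (Rlev k)`. [folklore] -/
theorem taxi_hcross (k : ℕ) {a : ℝ}
    (ha : ∀ x κ ι, ‖Rlev L M R' k x κ * Rlev L M R' k (x + unitVec (fine (L ^ k) M) κ) ι - Rlev L M R' k x ι * Rlev L M R' k (x + unitVec (fine (L ^ k) M) ι) κ‖ ≤ a)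
    (y : Tor M) (j : Fin d → Fin (L ^ k)) (μ : Fin d) (hj : (j μ : ℕ) + 1 = L ^ k) :
    ‖taxiTv (L ^ k) M (Rlev L M R' k) (bpt (L ^ k) M y j) * Rlev L M R' k (bpt (L ^ k) M y j) μ
        - coarseTv (L ^ k) M (Rlev L M R' k) y μ * taxiTv (L ^ k) M (Rlev L M R' k) (bpt (L ^ k) M y j + unitVec (fine (L ^ k) M) μ)‖
      ≤ ((d - 1 : ℕ) : ℝ) * ((L ^ k - 1 : ℕ) : ℝ) * ((2 * L ^ k - 1 : ℕ) : ℝ) * a := by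
  have hR : ∀ x μ, ‖Rlev L M R' k x μ‖ ≤ 1 := fun x μ => norm_le_one_of_mem_unitary (Rlev_mem_unitary L M hU k x μ)
  have h := cross_defect_taxiTv_le (L ^ k) M hR ha y j μ hj
  rwa [norm_sub_rev] at h

include hU hb hcoh in
/-- **THE TWO-LEVEL CARRIERS OF THE SUPPLIER ARE `γ_F`-CLOSE TO A FRAME-ADAPTED REFERENCE**: `‖compL (nestLv k) (frameT T′ (Rlev k)) − frameT (L^k·L) M (compTv T T′) Rc‖ ≤ γ_F`,
`γ_F = (E_k) + 3((d−1)L^k(L^k−1)a) + (d−1)(L^k−1)(2L^k−1)a`, `Rc = coarseTv (L^k) M (Rlev k)`. [folklore] -/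
theorem compL_nestLv_frameT_near (k : ℕ) {a : ℝ}
    (ha : ∀ x κ ι, ‖Rlev L M R' k x κ * Rlev L M R' k (x + unitVec (fine (L ^ k) M) κ) ι - Rlev L M R' k x ι * Rlev L M R' k (x + unitVec (fine (L ^ k) M) ι) κ‖ ≤ a)
    (y : Tor M) (Jx : Fin d → Fin (L ^ k * L)) (Ux : Fin (L ^ k * L)) (μ : Fin d) :
    ‖compL (L ^ k) L M (nestLv L M R' k) (frameT L (fine (L ^ k) M) (taxiTv L (fine (L ^ k) M) (R' k)) (Rlev L M R' k)) y Jx Ux μ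
        - frameT (L ^ k * L) M (compTv (L ^ k) L M (taxiTv (L ^ k) M (Rlev L M R' k)) (taxiTv L (fine (L ^ k) M) (R' k)))
            (coarseTv (L ^ k) M (Rlev L M R' k)) y Jx Ux μ‖
      ≤ (∑ q ∈ Finset.range k, ((((d - 1 : ℕ) : ℝ) + (d : ℝ) * d) * (((L : ℝ) * ((L ^ q - 1 : ℕ) : ℝ) * ((L - 1 : ℕ) : ℝ)) * b q)))
        + 3 * (((d - 1 : ℕ) : ℝ) * (L ^ k : ℕ) * ((L ^ k - 1 : ℕ) : ℝ) * a)
        + ((d - 1 : ℕ) : ℝ) * ((L ^ k - 1 : ℕ) : ℝ) * ((2 * L ^ k - 1 : ℕ) : ℝ) * a := by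
  have hR'1 : ∀ k x μ, ‖R' k x μ‖ ≤ 1 := fun k x μ => norm_le_one_of_mem_unitary (hU k x μ)
  have hRk : ∀ x μ, ‖Rlev L M R' k x μ‖ ≤ 1 := fun x μ => norm_le_one_of_mem_unitary (Rlev_mem_unitary L M hU k x μ)
  have hT'1 : ∀ x, ‖taxiTv L (fine (L ^ k) M) (R' k) x‖ ≤ 1 := norm_taxiTv_le_one L (fine (L ^ k) M) (hR'1 k)
  have hRc1 : ∀ y μ, ‖coarseTv (L ^ k) M (Rlev L M R' k) y μ‖ ≤ 1 := norm_coarseTv_le_one (L ^ k) M hRk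
  have ha0 : 0 ≤ a := (norm_nonneg _).trans (ha 0 μ μ)
  have hm0 : 0 ≤ ((d - 1 : ℕ) : ℝ) * ((L ^ k - 1 : ℕ) : ℝ) * ((2 * L ^ k - 1 : ℕ) : ℝ) * a := by positivity
  -- (E_k) + lines-vs-frames at level k: the nested carriers against the frame-adapted reference of the straight taxi
  have hnear : ∀ y j t μ, ‖nestLv L M R' k y j t μ - frameT (L ^ k) M (taxiTv (L ^ k) M (Rlev L M R' k)) (coarseTv (L ^ k) M (Rlev L M R' k)) y j t μ‖
      ≤ (∑ q ∈ Finset.range k, ((((d - 1 : ℕ) : ℝ) + (d : ℝ) * d) * (((L : ℝ) * ((L ^ q - 1 : ℕ) : ℝ) * ((L - 1 : ℕ) : ℝ)) * b q)))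
        + 3 * (((d - 1 : ℕ) : ℝ) * (L ^ k : ℕ) * ((L ^ k - 1 : ℕ) : ℝ) * a) := by
    intro y j t μ
    have h1 := nestLv_sub_lineT_le L M hR'1 hb hcoh k y j t μ
    have h2 := lineT_sub_frameT_taxi_le (L ^ k) M hRk ha y j t μ
    calc _ ≤ ‖nestLv L M R' k y j t μ - lineT (L ^ k) M (taxiTv (L ^ k) M (Rlev L M R' k)) (Rlev L M R' k) y j t μ‖
          + ‖lineT (L ^ k) M (taxiTv (L ^ k) M (Rlev L M R' k)) (Rlev L M R' k) y j t μ
            - frameT (L ^ k) M (taxiTv (L ^ k) M (Rlev L M R' k)) (coarseTv (L ^ k) M (Rlev L M R' k)) y j t μ‖ := norm_sub_le_norm_sub_add_norm_sub _ _ _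
      _ ≤ _ := add_le_add h1 (by simpa only [Nat.cast_pow] using h2)
  -- the composite of two frame-adapted references IS the frame-adapted reference of the composite frames, up to `m`
  have hcomp := norm_compL_frameT_sub_le (L ^ k) L M (U := taxiTv (L ^ k) M (Rlev L M R' k)) (U' := taxiTv L (fine (L ^ k) M) (R' k))
    (Rc := coarseTv (L ^ k) M (Rlev L M R' k)) (R := Rlev L M R' k) hRc1 hT'1 hm0 (taxi_hin L M hU k ha) (taxi_hcross L M hU k ha) y Jx Ux μ
  have hswap := norm_compL_sub_compL_le (L ^ k) L M (T := nestLv L M R' k)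
    (S := frameT (L ^ k) M (taxiTv (L ^ k) M (Rlev L M R' k)) (coarseTv (L ^ k) M (Rlev L M R' k)))
    (T' := frameT L (fine (L ^ k) M) (taxiTv L (fine (L ^ k) M) (R' k)) (Rlev L M R' k)) (norm_frameT_le_one L hT'1 hRk) hnear y Jx Ux μ
  calc _ ≤ ‖compL (L ^ k) L M (nestLv L M R' k) (frameT L (fine (L ^ k) M) (taxiTv L (fine (L ^ k) M) (R' k)) (Rlev L M R' k)) y Jx Ux μ
          - compL (L ^ k) L M (frameT (L ^ k) M (taxiTv (L ^ k) M (Rlev L M R' k)) (coarseTv (L ^ k) M (Rlev L M R' k)))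
              (frameT L (fine (L ^ k) M) (taxiTv L (fine (L ^ k) M) (R' k)) (Rlev L M R' k)) y Jx Ux μ‖
        + ‖compL (L ^ k) L M (frameT (L ^ k) M (taxiTv (L ^ k) M (Rlev L M R' k)) (coarseTv (L ^ k) M (Rlev L M R' k)))
              (frameT L (fine (L ^ k) M) (taxiTv L (fine (L ^ k) M) (R' k)) (Rlev L M R' k)) y Jx Ux μ
          - frameT (L ^ k * L) M (compTv (L ^ k) L M (taxiTv (L ^ k) M (Rlev L M R' k)) (taxiTv L (fine (L ^ k) M) (R' k)))
              (coarseTv (L ^ k) M (Rlev L M R' k)) y Jx Ux μ‖ := norm_sub_le_norm_sub_add_norm_sub _ _ _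
    _ ≤ _ := add_le_add hswap hcomp

end Near

/-! ## §2 The fine V-UB for the supplier's composite fibre, k-uniformly -/

section UB

include hU hb hcoh

/-- **`hUBfV` AT BAŁABAN's TAXI DATA** (leaf-01-g9's displayed fine V-UB for (`Q₁ = QvL L _ (frameT T′ (Rlev k))`, `G₁′ = projG (R′ k) (ker (Q_T ∘ Q_{T′}))`)): the level-(k+1)
V-UB for carriers near the frame-adapted reference of the composite frames (leaf-03-g4's `exists_ubV_nearFrame_ScV`, in-block class `w_k` of file 2, (GF1′) `projG ≤ d·rough`)
read in two-level letters by `ubV_transport`; ONE displayed smallness `κᵥ⁻¹·γ_F < 1`. [folklore] -/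
theorem hUBfV_taxi (hd : 1 ≤ d) (k : ℕ) {a : ℝ} (ha0 : 0 ≤ a)
    (ha : ∀ x κ ι, ‖Rlev L M R' k x κ * Rlev L M R' k (x + unitVec (fine (L ^ k) M) κ) ι - Rlev L M R' k x ι * Rlev L M R' k (x + unitVec (fine (L ^ k) M) ι) κ‖ ≤ a)
    (hb0 : 0 ≤ b k)
    (hc : (kappaV d (L ^ k * L))⁻¹
        * ((∑ q ∈ Finset.range k, ((((d - 1 : ℕ) : ℝ) + (d : ℝ) * d) * (((L : ℝ) * ((L ^ q - 1 : ℕ) : ℝ) * ((L - 1 : ℕ) : ℝ)) * b q)))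
            + 3 * (((d - 1 : ℕ) : ℝ) * (L ^ k : ℕ) * ((L ^ k - 1 : ℕ) : ℝ) * a)
            + ((d - 1 : ℕ) : ℝ) * ((L ^ k - 1 : ℕ) : ℝ) * ((2 * L ^ k - 1 : ℕ) : ℝ) * a) < 1)
    (φ : Tor M → Fin d → ℂ) :
    ∃ W' : Tor (fine L (fine (L ^ k) M)) → Fin d → ℂ,
      QvL (L ^ k) M (nestLv L M R' k) (QvL L (fine (L ^ k) M) (frameT L (fine (L ^ k) M) (taxiTv L (fine (L ^ k) M) (R' k)) (Rlev L M R' k)) W') = φ ∧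
      SfV (L ^ k) L M (R' k) (projG (fine L (fine (L ^ k) M)) (R' k)
          (LinearMap.ker ((avgOp (L ^ k) M (taxiTv (L ^ k) M (Rlev L M R' k))).comp (avgOp L (fine (L ^ k) M) (taxiTv L (fine (L ^ k) M) (R' k)))))) W'
        ≤ lamV d ((L ^ k * L : ℕ) * (((d - 1 : ℕ) : ℝ) * ((L - 1 : ℕ) : ℝ) * ((2 * L - 1 : ℕ) : ℝ) * b k + ((d - 1 : ℕ) : ℝ) * ((L ^ k - 1 : ℕ) : ℝ) * a)) d
            (((L ^ k * L : ℕ) : ℝ) ^ 2 * 0)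
          / (1 - (kappaV d (L ^ k * L))⁻¹
              * ((∑ q ∈ Finset.range k, ((((d - 1 : ℕ) : ℝ) + (d : ℝ) * d) * (((L : ℝ) * ((L ^ q - 1 : ℕ) : ℝ) * ((L - 1 : ℕ) : ℝ)) * b q)))
                + 3 * (((d - 1 : ℕ) : ℝ) * (L ^ k : ℕ) * ((L ^ k - 1 : ℕ) : ℝ) * a)
                + ((d - 1 : ℕ) : ℝ) * ((L ^ k - 1 : ℕ) : ℝ) * ((2 * L ^ k - 1 : ℕ) : ℝ) * a)) ^ 2 * nsqV M φ := by
  have hUk : ∀ x μ, Rlev L M R' k x μ ∈ unitary (ℂ →L[ℂ] ℂ) := Rlev_mem_unitary L M hU k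
  have hUk1 : ∀ x μ, Rlev L M R' (k + 1) x μ ∈ unitary (ℂ →L[ℂ] ℂ) := Rlev_mem_unitary L M hU (k + 1)
  have hRk1 : ∀ x μ, ‖Rlev L M R' (k + 1) x μ‖ ≤ 1 := fun x μ => norm_le_one_of_mem_unitary (hUk1 x μ)
  have hC : coarseTv L (fine (L ^ k) M) (R' k) = Rlev L M R' k := coarseTv_eq_Rlev L M R' hcoh k
  have haC : ∀ y κ ι, ‖coarseTv L (fine (L ^ k) M) (R' k) y κ * coarseTv L (fine (L ^ k) M) (R' k) (y + unitVec (fine (L ^ k) M) κ) ι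
      - coarseTv L (fine (L ^ k) M) (R' k) y ι * coarseTv L (fine (L ^ k) M) (R' k) (y + unitVec (fine (L ^ k) M) ι) κ‖ ≤ a := by rw [hC]; exact ha
  have hUcp : ∀ x, compTv (L ^ k) L M (taxiTv (L ^ k) M (Rlev L M R' k)) (taxiTv L (fine (L ^ k) M) (R' k)) x ∈ unitary (ℂ →L[ℂ] ℂ) :=
    compTv_mem_unitary (L ^ k) L M (taxiTv_mem_unitary (L ^ k) M hUk) (taxiTv_mem_unitary L (fine (L ^ k) M) (hU k))
  have hw0 : 0 ≤ ((d - 1 : ℕ) : ℝ) * ((L - 1 : ℕ) : ℝ) * ((2 * L - 1 : ℕ) : ℝ) * b k + ((d - 1 : ℕ) : ℝ) * ((L ^ k - 1 : ℕ) : ℝ) * a := by positivity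
  -- the in-block class of the composite frames w.r.t. `Rlev (k+1) = Rtrv (R′ k)` (file 2, coarse frames rewritten by coherence)
  have hw : ∀ (y : Tor M) (j : Fin d → Fin (L ^ k * L)) (ν : Fin d), (j ν : ℕ) + 1 < L ^ k * L →
      ‖Rlev L M R' (k + 1) (bpt (L ^ k * L) M y j) ν
          * star (compTv (L ^ k) L M (taxiTv (L ^ k) M (Rlev L M R' k)) (taxiTv L (fine (L ^ k) M) (R' k)) (bpt (L ^ k * L) M y j + unitVec (fine (L ^ k * L) M) ν))
          * compTv (L ^ k) L M (taxiTv (L ^ k) M (Rlev L M R' k)) (taxiTv L (fine (L ^ k) M) (R' k)) (bpt (L ^ k * L) M y j) - 1‖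
        ≤ ((d - 1 : ℕ) : ℝ) * ((L - 1 : ℕ) : ℝ) * ((2 * L - 1 : ℕ) : ℝ) * b k + ((d - 1 : ℕ) : ℝ) * ((L ^ k - 1 : ℕ) : ℝ) * a := by
    intro y j ν hj
    have h := inBlock_defect_compTv_le (L ^ k) L M (hU k) (hb k) haC y j ν hj
    rw [hC] at h
    exact h
  -- (GF1′) for the composite-kernel functional at level k+1
  have hG : ∀ W, Gtr (L ^ k) L M (projG (fine L (fine (L ^ k) M)) (R' k)
      (LinearMap.ker ((avgOp (L ^ k) M (taxiTv (L ^ k) M (Rlev L M R' k))).comp (avgOp L (fine (L ^ k) M) (taxiTv L (fine (L ^ k) M) (R' k)))))) W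
        ≤ d * roughV (L ^ (k + 1)) M (Rlev L M R' (k + 1)) W + 0 * nsqV (fine (L ^ (k + 1)) M) W := fun W => by
    rw [Gtr_G1']
    exact hGF_projG_taxi L M hU (k + 1) _ W
  have h := exists_ubV_nearFrame_ScV (L ^ k * L) M hUcp (compL_nestLv_frameT_near L M hU hb hcoh k ha) hc hRk1 hw0 hw hd (Nat.cast_nonneg d) le_rfl hG φ
  exact (ubV_transport (L ^ k) L M).mpr h

end UB

end Summit.QuantumFields.BalabanUV.T4Continuum.VariationalColourTaxiTransport

end
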